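import Mathlib
import Literature.AlgebraicGeometry.Resolution.ResolutionOfSingularities
import Literature.AlgebraicGeometry.Resolution.QuasiProjectiveResolution
import Literature.AlgebraicGeometry.Morphisms.IsoOverOpen
import HarnessLib

/-!
# Resolutions localize: `Spec M⁻¹B` is resolved by the base change of a resolution of `Spec B`

Topic: `Literature/AlgebraicGeometry/Resolution`. For a domain `B`, a multiplicative subset `M`
(not containing `0`) and a (weak) resolution of singularities `π : X' → Spec B` — proper,
birational (an isomorphism over a dense open with dense preimage), `X'` regular — the base change
`X' ×_{Spec B} Spec M⁻¹B → Spec M⁻¹B` is again a resolution: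

* it is proper (base change);
* its source is regular: the projection `X' ×_{Spec B} Spec M⁻¹B → X'` is flat and surjective
  on stalks (base change of `Spec M⁻¹B → Spec B`, a flat preimmersion), so its stalk maps are
  flat local surjections of local rings, i.e. isomorphisms
  (`Scheme.IsRegular.of_flat_of_surjectiveOnStalks`);
* it is birational: it is an isomorphism over the preimage of the dense open (isomorphisms over
  an open base-change, `Morphisms/IsoOverOpen`), which contains the generic point of `Spec M⁻¹B`,
  and the preimage of that open in the (irreducible) base change contains the point over the
  generic point of `X'`, which is generic there.

Consequence (`hasResolution_Spec_of_essFiniteType`): if every reduced affine scheme of finite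
type over a field `k₀` has a resolution, so does `Spec B` for every domain `B` ESSENTIALLY of
finite type over `k₀` (a localization of a finitely generated `k₀`-algebra) — e.g. every
integral affine scheme of finite type over a finitely generated extension field `k ⊇ k₀`. This
is the standard "spreading out and localizing" step (EGA IV₃ 8.8.2, 8.10.5; here only the easy
half: a resolution of a model localizes to a resolution of the generic/essential fibre).

## Sources
* A. Grothendieck, *EGA* IV₃ (Publ. Math. IHÉS 28, 1966), §8.8–8.10 (limits of schemes).
  [EGAIV3]
* J. Kollár, *Lectures on Resolution of Singularities*, Princeton 2007, 3.4 (weak resolution;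
  the problem is local on the base only up to patching). [Kollar2007]
All statements below are folklore consequences; no named fact is introduced.
-/

noncomputable section

open CategoryTheory CategoryTheory.Limits AlgebraicGeometry TopologicalSpace Topology

namespace Literature.AlgebraicGeometry.Resolution

universe u

/-! ## Regularity ascends along flat morphisms that are surjective on stalks -/

/-- **Regularity ascends along flat morphisms surjective on stalks** (e.g. base changes of
localizations `Spec M⁻¹B → Spec B`): the stalk maps are flat local homomorphisms of local
rings, hence faithfully flat and injective, and surjective by hypothesis — so they are
isomorphisms and every local ring of the source is a local ring of the target. [folklore] -/
theorem Scheme.IsRegular.of_flat_of_surjectiveOnStalks {X' X : Scheme.{u}} (φ : X' ⟶ X)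
    [Flat φ] [SurjectiveOnStalks φ] (hX : Scheme.IsRegular X) : Scheme.IsRegular X' := by
  intro x'
  algebraize [(φ.stalkMap x').hom]
  haveI : IsLocalHom (algebraMap (X.presheaf.stalk (φ x')) (X'.presheaf.stalk x')) :=
    inferInstanceAs <| IsLocalHom (φ.stalkMap x').hom
  haveI : Module.Flat (X.presheaf.stalk (φ x')) (X'.presheaf.stalk x') := Flat.stalkMap φ x'
  haveI : IsRegularLocalRing (X.presheaf.stalk (φ x')) := hX (φ x')
  haveI : Module.FaithfullyFlat (X.presheaf.stalk (φ x')) (X'.presheaf.stalk x') :=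
    Module.FaithfullyFlat.of_flat_of_isLocalHom
  have hinj : Function.Injective (φ.stalkMap x').hom :=
    FaithfulSMul.algebraMap_injective (X.presheaf.stalk (φ x')) (X'.presheaf.stalk x')
  exact IsRegularLocalRing.of_ringEquiv
    (RingEquiv.ofBijective (φ.stalkMap x').hom ⟨hinj, φ.stalkMap_surjective x'⟩)

/-! ## Generic points -/

section Generic

variable {B S : Type u} [CommRing B] [CommRing S] [Algebra B S] [IsDomain B] [IsDomain S]

/-- For an injective ring map of domains `B → S`, `Spec S → Spec B` maps the generic point to
the generic point. [folklore] -/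
theorem specMap_genericPoint_of_injective (hinj : Function.Injective (algebraMap B S)) :
    (Spec.map (CommRingCat.ofHom (algebraMap B S))) (genericPoint (Spec (.of S))) =
      genericPoint (Spec (.of B)) := by
  rw [genericPoint_eq_bot_of_affine, genericPoint_eq_bot_of_affine]
  apply PrimeSpectrum.ext
  change Ideal.comap (algebraMap B S) ⊥ = ⊥
  rw [Ideal.comap_bot_of_injective _ hinj]

end Generic

/-- In an irreducible (quasi-sober) space the generic point lies in every nonempty open set.
[folklore] -/
theorem genericPoint_mem_of_isOpen {α : Type*} [TopologicalSpace α] [QuasiSober α]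
    [IrreducibleSpace α] {U : Set α} (hU : IsOpen U) (hne : U.Nonempty) :
    genericPoint α ∈ U := by
  rw [(genericPoint_spec α).mem_open_set_iff hU]
  simpa using hne

/-- A set containing the generic point of an irreducible space is dense. [folklore] -/
theorem dense_of_genericPoint_mem_of_irreducibleSpace {α : Type*} [TopologicalSpace α]
    [QuasiSober α] [IrreducibleSpace α] {s : Set α} (hs : genericPoint α ∈ s) : Dense s :=
  Dense.mono (Set.singleton_subset_iff.mpr hs)
    (by rw [dense_iff_closure_eq]; exact genericPoint_closure α)

/-- Along a morphism `π : X' → X` of irreducible schemes which is an isomorphism over a dense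
open `U`, the generic point goes to the generic point (the image of `π` contains `U`, so the
closure of `π ξ'` is everything). [folklore] -/
theorem apply_genericPoint_eq_of_isIso_morphismRestrict {X' X : Scheme.{u}}
    [IrreducibleSpace X'] [IrreducibleSpace X] (π : X' ⟶ X) (U : X.Opens)
    (hU : Dense (U : Set X)) [IsIso (π ∣_ U)] : π (genericPoint X') = genericPoint X := by
  have hgen : IsGenericPoint (π (genericPoint X')) (Set.univ : Set X) := by
    rw [isGenericPoint_iff_specializes]
    intro y
    simp only [Set.mem_univ, iff_true]
    -- closure of `π ξ'` contains `π '' univ ⊇ U`, hence everything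
    have hcl : (U : Set X) ⊆ closure {π (genericPoint X')} := by
      intro u hu
      -- `u = π x` for some `x`, since `π ∣_ U` is an isomorphism (surjective)
      haveI : IsIso (π ∣_ U).base := inferInstance
      obtain ⟨x, hx⟩ := (TopCat.homeoOfIso (asIso (π ∣_ U).base)).surjective ⟨u, hu⟩
      have hxu : π x.1 = u := by
        have := congrArg Subtype.val hx
        rw [← morphismRestrict_base_coe π U x]
        exact this
      rw [← hxu]
      have hspec : genericPoint X' ⤳ x.1 := genericPoint_specializes x.1
      exact (hspec.map π.continuous).mem_closure
    have hcl' : closure (U : Set X) ⊆ closure {π (genericPoint X')} :=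
      closure_minimal hcl isClosed_closure
    rw [hU.closure_eq] at hcl'
    exact specializes_iff_mem_closure.mpr (hcl' (Set.mem_univ y))
  exact hgen.eq (genericPoint_spec X)

/-! ## The base change of a resolution to a localization -/

section Localization

variable {B S : Type u} [CommRing B] [CommRing S] [Algebra B S]

/-- **Birationality survives base change to a localization.** For domains `B ⊆ S = M⁻¹B` and
a birational `π : X' → Spec B` (so `X'` is irreducible), the base change
`X' ×_{Spec B} Spec S → Spec S` is birational: it is an isomorphism over the preimage `U_S` of
the dense open `U`, which contains the generic point of `Spec S`; and its own preimage contains the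
point over `(ξ', η_S)`, `ξ'` the generic point of `X'`, which is generic in the base change
because the projection to `X'` is a topological embedding. [folklore] -/
theorem IsBirational.pullback_snd_isLocalization (M : Submonoid B) [IsLocalization M S]
    [IsDomain B] [IsDomain S] {X' : Scheme.{u}} (π : X' ⟶ Spec (.of B)) (hπ : IsBirational π) :
    IsBirational (pullback.snd π (Spec.map (CommRingCat.ofHom (algebraMap B S)))) := by
  set ι : Spec (.of S) ⟶ Spec (.of B) := Spec.map (CommRingCat.ofHom (algebraMap B S)) with hι
  obtain ⟨U, hU, hU', hiso⟩ := hπ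
  haveI := hiso
  haveI : IrreducibleSpace (Spec (.of B) : Scheme.{u}) :=
    inferInstanceAs (IrreducibleSpace (PrimeSpectrum B))
  haveI : IrreducibleSpace (Spec (.of S) : Scheme.{u}) :=
    inferInstanceAs (IrreducibleSpace (PrimeSpectrum S))
  haveI : IrreducibleSpace X' := IsBirational.irreducibleSpace ⟨U, hU, hU', hiso⟩
  have hM : M ≤ nonZeroDivisors B := by
    intro m hm
    refine mem_nonZeroDivisors_of_ne_zero ?_
    rintro rfl
    have hu := IsLocalization.map_units S (⟨0, hm⟩ : M)
    simp only [map_zero, isUnit_zero_iff] at hu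
    exact zero_ne_one hu
  have hinj : Function.Injective (algebraMap B S) := IsLocalization.injective S hM
  haveI : IsPreimmersion ι := IsPreimmersion.of_isLocalization M
  -- generic points: `ι η_S = η = π ξ'`
  have hιη : ι (genericPoint (Spec (.of S))) = genericPoint (Spec (.of B)) :=
    specMap_genericPoint_of_injective hinj
  have hπξ : π (genericPoint X') = genericPoint (Spec (.of B)) :=
    apply_genericPoint_eq_of_isIso_morphismRestrict π U hU
  have hηU : genericPoint (Spec (.of B)) ∈ (U : Set (Spec (.of B))) :=
    genericPoint_mem_of_isOpen U.2 hU.nonempty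
  obtain ⟨z, hz1, hz2⟩ := Scheme.Pullback.exists_preimage_pullback (f := π) (g := ι)
    (genericPoint X') (genericPoint (Spec (.of S))) (hπξ.trans hιη.symm)
  refine ⟨ι ⁻¹ᵁ U, ?_, ?_,
    Literature.AlgebraicGeometry.Morphisms.isIso_morphismRestrict_pullback_snd π ι U⟩
  · -- `ι⁻¹ U` contains the generic point of `Spec S`
    refine dense_of_genericPoint_mem_of_irreducibleSpace ?_
    change ι (genericPoint (Spec (.of S))) ∈ (U : Set (Spec (.of B)))
    rwa [hιη]
  · -- the preimage contains the point `z` over `(ξ', η_S)`, which is a generic point of the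
    -- base change (the projection to `X'` is an embedding)
    have hz :
        z ∈ ((pullback.snd π ι ⁻¹ᵁ ι ⁻¹ᵁ U : (pullback π ι).Opens) : Set _) := by
      change ι (pullback.snd π ι z) ∈ (U : Set (Spec (.of B)))
      rw [hz2, hιη]
      exact hηU
    refine Dense.mono (Set.singleton_subset_iff.mpr hz) ?_
    rw [dense_iff_inter_open]
    intro W hW hWne
    obtain ⟨t, ht, htW⟩ := (pullback.fst π ι).isEmbedding.isInducing.isOpen_iff.mp hW
    obtain ⟨w, hw⟩ := hWne
    have hwt : (pullback.fst π ι) w ∈ t := by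
      rw [← htW] at hw
      exact hw
    have hξt : genericPoint X' ∈ t := genericPoint_mem_of_isOpen ht ⟨_, hwt⟩
    refine ⟨z, ?_, rfl⟩
    rw [← htW]
    change (pullback.fst π ι) z ∈ t
    rwa [hz1]

/-- **Resolutions localize** (the easy half of the limit formalism for resolutions): if `B` is
a domain, `S = M⁻¹B` a localization which is a domain (i.e. `0 ∉ M`), and `Spec B` has a weak
resolution of singularities, then so does `Spec S` — the base change of the resolution is
proper, regular (flat preimmersion) and birational. [cite: EGAIV3, 8.10.5] -/
theorem Scheme.HasResolution.of_isLocalization (M : Submonoid B) [IsLocalization M S]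
    [IsDomain B] [IsDomain S] (h : Scheme.HasResolution (Spec (.of B))) :
    Scheme.HasResolution (Spec (.of S)) := by
  obtain ⟨X', π, hπ⟩ := h
  haveI := hπ.isProper
  set ι : Spec (.of S) ⟶ Spec (.of B) := Spec.map (CommRingCat.ofHom (algebraMap B S)) with hι
  haveI : IsPreimmersion ι := IsPreimmersion.of_isLocalization M
  haveI : Flat ι := by
    rw [hι, Flat.SpecMap_iff, CommRingCat.hom_ofHom, RingHom.flat_algebraMap_iff]
    exact IsLocalization.flat S M
  exact ⟨pullback π ι, pullback.snd π ι, inferInstance,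
    hπ.isBirational.pullback_snd_isLocalization M,
    hπ.isRegular.of_flat_of_surjectiveOnStalks (pullback.fst π ι)⟩

/-- The localization `Localization M` of a domain at a submonoid not containing `0` inherits a
resolution from `Spec B`. [cite: EGAIV3, 8.10.5] -/
theorem Scheme.HasResolution.localization [IsDomain B] (M : Submonoid B)
    (hM : M ≤ nonZeroDivisors B) (h : Scheme.HasResolution (Spec (.of B))) :
    Scheme.HasResolution (Spec (.of (Localization M))) := by
  haveI : IsDomain (Localization M) := IsLocalization.isDomain_localization hM
  exact Scheme.HasResolution.of_isLocalization (S := Localization M) M h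

end Localization

/-! ## Essentially-of-finite-type algebras -/

/-- **Resolution for algebras essentially of finite type.** If `B` is a domain essentially of
finite type over `k₀` (a localization of a finitely generated `k₀`-subalgebra) and the spectra
of its finitely generated `k₀`-subalgebras have weak resolutions, then `Spec B` has one. E.g.
the spectrum of a domain of finite type over a finitely generated field extension `k ⊇ k₀` is
resolved as soon as finite-type `k₀`-domains are. [cite: EGAIV3, 8.8.2 and 8.10.5] -/
theorem hasResolution_Spec_of_essFiniteType (k₀ : Type u) [CommRing k₀] (B : Type u)
    [CommRing B] [IsDomain B] [Algebra k₀ B] [Algebra.EssFiniteType k₀ B]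
    (h : ∀ C : Subalgebra k₀ B, Algebra.FiniteType k₀ C →
      Scheme.HasResolution (Spec (.of C))) :
    Scheme.HasResolution (Spec (.of B)) :=
  Scheme.HasResolution.of_isLocalization (Algebra.EssFiniteType.submonoid k₀ B)
    (h (Algebra.EssFiniteType.subalgebra k₀ B) inferInstance)

end Literature.AlgebraicGeometry.Resolution

end
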